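import Mathlib
import Summits.ValiantsHypothesis.ValiantsHypothesis.Theorems.LacunarySymmetroidMatrixDescartesMonotoneIncoherence

/-!
# `MatrixDescartes` (stmt-ValiantsHypothesis-18050) — INCOHERENCE REPLACES SIZE IN THE ONE-TYPE WINDOW LAWS: on every window
# whose roots are of one type a word carries at most `k` roots (with multiplicity), and on a definite-type window the
# numbers of negative-type and positive-type roots differ by at most `k` — `k` the number of columns outside a
# sign-coherent core, at every size

HONEST FRAMING.  Cell `pub-symmetroid`, seat `val-sym-mdr-p2` (gen 20); helper file `--supports` the crux
`Theses.LacunarySymmetroid.MatrixDescartes` (OPEN), NO closure claim; companion of `…InertiaBand` (the band law) and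
`…MonotoneIncoherence` (option-pencil form of a word), on top of the lineage's window laws `…InertiaIndexFormula`
(`Inertia.card_roots_Ioo_add_negIndex_eq_of_posType/negType`, `Inertia.index_formula`).  TWO-SIDED statements (any signs,
any exponents, any size) with the TYPE hypothesis of the tree's inertia calculus; nothing here bears on the crux in its
window, `stub_twoSided`, `DoorA26` / `DoorA34`, registers, or `VP ≠ VNP`.

SETTING.  `F(x) = x^eB + U₀ diag(σ₀x^{δ₀}) U₀ᵀ + U₁ diag(σ₁x^{δ₁}) U₁ᵀ`, `B` real symmetric non-degenerate, the CORE `U₀`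
sign-coherent (Gram PSD on its positive columns, NSD on its negative ones), `k = |ρ₁|` extra columns; written as the
lacunary pencil with letters indexed by `Option (ρ₀ ⊕ ρ₁)` (`GramDual.word_eq_optionPencil`), so that «root of positive /
negative type» is the tree's notion (sign of `P_u′(t)` for the kernel vectors `u` of `F(t)`).

* **`card_roots_window_le_of_posType` / `…_of_negType` (ONE-TYPE WINDOWS CARRY ≤ k ROOTS).**  `a < b` non-singular scales,
  every root in `(a, b)` of positive (resp. negative) type ⇒ the roots in `(a, b)` counted with multiplicity number at most
  `k` (tree: exactly `ν(F(a)) − ν(F(b))` resp. `ν(F(b)) − ν(F(a))`; band: both indices lie in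
  `[ν(B) − #{σ₁>0}, ν(B) + #{σ₁<0}]`, an interval of length `k`).  The lineage's one-type law had the budget `m = |ι|`.
* **`negType_sub_posType_le_of_definiteType` (DEFINITE-TYPE WINDOWS).**  If every root in `(a, b)` is of definite type, the
  number `N⁻` of negative-type roots and the number `N⁺` of positive-type roots (with multiplicity) satisfy
  `N⁻ ≤ N⁺ + k` and `N⁺ ≤ N⁻ + k` (index formula `ν(F(b)) + N⁺ = ν(F(a)) + N⁻` + band) — beating `k` on such a window
  requires REVIVALS (roots of both types), exactly as beating `m` did before, with `m` replaced by the incoherence number.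
Nothing bounds the revivals; no two-sided count is claimed.

[folklore] (Sylvester's law of inertia; Haynsworth).  Axioms `propext`, `Classical.choice`, `Quot.sound`.
-/

-- layout Summits/ValiantsHypothesis/ValiantsHypothesis forces the duplicated namespace component
set_option linter.dupNamespace false

namespace Summit.ValiantsHypothesis.ValiantsHypothesis.Theorems.LacunarySymmetroidMatrixDescartes

open Polynomial Matrix Finset
open scoped BigOperators

namespace GramDual

section Window

variable {ι ρ₀ ρ₁ : Type} [Fintype ι] [DecidableEq ι] [Fintype ρ₀] [DecidableEq ρ₀] [Fintype ρ₁] [DecidableEq ρ₁]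
variable (B : Matrix ι ι ℝ) (U₀ : Matrix ι ρ₀ ℝ) (U₁ : Matrix ι ρ₁ ℝ) (σ₀ : ρ₀ → ℝ) (σ₁ : ρ₁ → ℝ) (e : ℕ)
  (δ₀ : ρ₀ → ℕ) (δ₁ : ρ₁ → ℕ)

/-- the option-indexed letters of the juxtaposed word (file-local notation, as in `…MonotoneIncoherence`) -/
local notation3 (prettyPrint := false) "𝕃" =>
  (fun o : Option (ρ₀ ⊕ ρ₁) => Option.elim o B
    (fun j => Sum.elim σ₀ σ₁ j •
      Matrix.vecMulVec (fun a => Matrix.fromCols U₀ U₁ a j) (fun a => Matrix.fromCols U₀ U₁ a j)))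

/-- the option-indexed exponents (file-local notation) -/
local notation3 (prettyPrint := false) "𝕕" => (fun o : Option (ρ₀ ⊕ ρ₁) => Option.elim o e (Sum.elim δ₀ δ₁))

/-- the evaluated option pencil `F(x)` (file-local notation) -/
local notation3 (prettyPrint := false) "𝔽o[" x "]" => (∑ o : Option (ρ₀ ⊕ ρ₁), (x : ℝ) ^ (𝕕 o) • 𝕃 o)

/-- the Rayleigh `K`-nomial of a vector `u` (file-local notation) -/
local notation3 (prettyPrint := false) "ℙ[" u "]" =>
  (∑ o : Option (ρ₀ ⊕ ρ₁), Polynomial.C ((u : ι → ℝ) ⬝ᵥ ((𝕃 o) *ᵥ (u : ι → ℝ))) * (Polynomial.X : Polynomial ℝ) ^ (𝕕 o))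

/-! ## §1  The band at a non-singular scale, in option-pencil currency -/

/-- The band law transported to the option-pencil presentation: at every `x > 0`,
`ν(B) ≤ ν(F(x)) + #{σ₁>0} ≤ ν(B) + k`. [folklore] -/
theorem negIndex_optionPencil_band (hBs : B.IsSymm) (hBu : IsUnit B.det) (hσ₀ : ∀ j, σ₀ j ≠ 0) (hσ₁ : ∀ j, σ₁ j ≠ 0)
    (hP : ∀ v : ρ₀ → ℝ, (∀ j, σ₀ j < 0 → v j = 0) → 0 ≤ v ⬝ᵥ ((U₀ᵀ * B⁻¹ * U₀) *ᵥ v))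
    (hN : ∀ v : ρ₀ → ℝ, (∀ j, 0 < σ₀ j → v j = 0) → v ⬝ᵥ ((U₀ᵀ * B⁻¹ * U₀) *ᵥ v) ≤ 0)
    {x : ℝ} (hx : 0 < x) (hB : B.IsHermitian) (hFx : (𝔽o[x]).IsHermitian) :
    Fintype.card {j // hB.eigenvalues j < 0} ≤ Fintype.card {j // hFx.eigenvalues j < 0} + Fintype.card {j // 0 < σ₁ j}
      ∧ Fintype.card {j // hFx.eigenvalues j < 0} + Fintype.card {j // 0 < σ₁ j}
        ≤ Fintype.card {j // hB.eigenvalues j < 0} + Fintype.card ρ₁ := by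
  classical
  have hF : (x ^ e • B + Matrix.fromCols U₀ U₁
      * Matrix.diagonal (fun j => Sum.elim σ₀ σ₁ j * x ^ (Sum.elim δ₀ δ₁ j)) * (Matrix.fromCols U₀ U₁)ᵀ).IsHermitian :=
    isHermitian_eval_word hBs (Matrix.fromCols U₀ U₁) (Sum.elim σ₀ σ₁) e (Sum.elim δ₀ δ₁) x
  have hband := (inertia_word_band B U₀ U₁ σ₀ σ₁ e δ₀ δ₁ hBs hBu hσ₀ hσ₁ hP hN hx hB hF).1
  have hν := Inertia.negIndex_congr hFx hF
    (eval_word_eq_optionPencil B (Matrix.fromCols U₀ U₁) (Sum.elim σ₀ σ₁) e (Sum.elim δ₀ δ₁) x).symm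
  rw [hν]
  exact hband

/-! ## §2  One-type windows carry at most `k` roots -/

/-- **POSITIVE-TYPE WINDOWS CARRY ≤ k ROOTS.**  `0 < a < b` with `F(a)`, `F(b)` non-singular and every root of `det F` in
`(a, b)` of positive type: the roots in `(a, b)` counted with multiplicity number at most `k = |ρ₁|`, the number of columns
outside the sign-coherent core. [folklore] -/
theorem card_roots_window_le_of_posType (hBs : B.IsSymm) (hBu : IsUnit B.det) (hσ₀ : ∀ j, σ₀ j ≠ 0)
    (hσ₁ : ∀ j, σ₁ j ≠ 0)
    (hP : ∀ v : ρ₀ → ℝ, (∀ j, σ₀ j < 0 → v j = 0) → 0 ≤ v ⬝ᵥ ((U₀ᵀ * B⁻¹ * U₀) *ᵥ v))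
    (hN : ∀ v : ρ₀ → ℝ, (∀ j, 0 < σ₀ j → v j = 0) → v ⬝ᵥ ((U₀ᵀ * B⁻¹ * U₀) *ᵥ v) ≤ 0)
    {a b : ℝ} (ha0 : 0 < a) (hab : a < b) (ha : (𝔽o[a]).det ≠ 0) (hb : (𝔽o[b]).det ≠ 0)
    (hpos : ∀ t, a < t → t < b → (𝔽o[t]).det = 0 → ∀ u : ι → ℝ, (𝔽o[t]) *ᵥ u = 0 → u ≠ 0 →
      0 < (derivative (ℙ[u])).eval t) :
    Multiset.card ((Matrix.det (∑ o : Option (ρ₀ ⊕ ρ₁), ((Polynomial.X : Polynomial ℝ) ^ (𝕕 o)) • (𝕃 o).map Polynomial.C)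
        ).roots.filter (fun t => a < t ∧ t < b)) ≤ Fintype.card ρ₁ := by
  classical
  have hS : ∀ o, (𝕃 o).IsSymm := isSymm_optionLetter hBs (Matrix.fromCols U₀ U₁) (Sum.elim σ₀ σ₁)
  have hB : B.IsHermitian := Inertia.isHermitian_of_isSymm hBs
  have hwin := (Inertia.card_roots_Ioo_add_negIndex_eq_of_posType (𝕕) (𝕃) hS hab ha hb hpos).1
  have hba := negIndex_optionPencil_band B U₀ U₁ σ₀ σ₁ e δ₀ δ₁ hBs hBu hσ₀ hσ₁ hP hN ha0 hB
    (Inertia.isHermitian_pencil (𝕕) (𝕃) hS a)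
  have hbb := negIndex_optionPencil_band B U₀ U₁ σ₀ σ₁ e δ₀ δ₁ hBs hBu hσ₀ hσ₁ hP hN (lt_trans ha0 hab) hB
    (Inertia.isHermitian_pencil (𝕕) (𝕃) hS b)
  have hk : Fintype.card {j // 0 < σ₁ j} ≤ Fintype.card ρ₁ := Fintype.card_subtype_le _
  beta_reduce
  omega

/-- **NEGATIVE-TYPE WINDOWS CARRY ≤ k ROOTS** (mirror). [folklore] -/
theorem card_roots_window_le_of_negType (hBs : B.IsSymm) (hBu : IsUnit B.det) (hσ₀ : ∀ j, σ₀ j ≠ 0)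
    (hσ₁ : ∀ j, σ₁ j ≠ 0)
    (hP : ∀ v : ρ₀ → ℝ, (∀ j, σ₀ j < 0 → v j = 0) → 0 ≤ v ⬝ᵥ ((U₀ᵀ * B⁻¹ * U₀) *ᵥ v))
    (hN : ∀ v : ρ₀ → ℝ, (∀ j, 0 < σ₀ j → v j = 0) → v ⬝ᵥ ((U₀ᵀ * B⁻¹ * U₀) *ᵥ v) ≤ 0)
    {a b : ℝ} (ha0 : 0 < a) (hab : a < b) (ha : (𝔽o[a]).det ≠ 0) (hb : (𝔽o[b]).det ≠ 0)
    (hneg : ∀ t, a < t → t < b → (𝔽o[t]).det = 0 → ∀ u : ι → ℝ, (𝔽o[t]) *ᵥ u = 0 → u ≠ 0 →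
      (derivative (ℙ[u])).eval t < 0) :
    Multiset.card ((Matrix.det (∑ o : Option (ρ₀ ⊕ ρ₁), ((Polynomial.X : Polynomial ℝ) ^ (𝕕 o)) • (𝕃 o).map Polynomial.C)
        ).roots.filter (fun t => a < t ∧ t < b)) ≤ Fintype.card ρ₁ := by
  classical
  have hS : ∀ o, (𝕃 o).IsSymm := isSymm_optionLetter hBs (Matrix.fromCols U₀ U₁) (Sum.elim σ₀ σ₁)
  have hB : B.IsHermitian := Inertia.isHermitian_of_isSymm hBs
  have hwin := (Inertia.card_roots_Ioo_add_negIndex_eq_of_negType (𝕕) (𝕃) hS hab ha hb hneg).1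
  have hba := negIndex_optionPencil_band B U₀ U₁ σ₀ σ₁ e δ₀ δ₁ hBs hBu hσ₀ hσ₁ hP hN ha0 hB
    (Inertia.isHermitian_pencil (𝕕) (𝕃) hS a)
  have hbb := negIndex_optionPencil_band B U₀ U₁ σ₀ σ₁ e δ₀ δ₁ hBs hBu hσ₀ hσ₁ hP hN (lt_trans ha0 hab) hB
    (Inertia.isHermitian_pencil (𝕕) (𝕃) hS b)
  have hk : Fintype.card {j // 0 < σ₁ j} ≤ Fintype.card ρ₁ := Fintype.card_subtype_le _
  beta_reduce
  omega

/-! ## §3  Definite-type windows: the two types differ by at most `k` -/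

/-- **DEFINITE-TYPE WINDOWS: THE TYPE COUNTS DIFFER BY AT MOST k.**  `0 < a < b` non-singular scales, every root in `(a, b)` of
definite type, `negType` any predicate agreeing with «negative type» on those roots: with `N⁻`, `N⁺` the numbers of
negative-type / remaining roots in `(a, b)` counted with multiplicity, `N⁻ ≤ N⁺ + k` and `N⁺ ≤ N⁻ + k`. [folklore] -/
theorem negType_sub_posType_le_of_definiteType (hBs : B.IsSymm) (hBu : IsUnit B.det) (hσ₀ : ∀ j, σ₀ j ≠ 0)
    (hσ₁ : ∀ j, σ₁ j ≠ 0)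
    (hP : ∀ v : ρ₀ → ℝ, (∀ j, σ₀ j < 0 → v j = 0) → 0 ≤ v ⬝ᵥ ((U₀ᵀ * B⁻¹ * U₀) *ᵥ v))
    (hN : ∀ v : ρ₀ → ℝ, (∀ j, 0 < σ₀ j → v j = 0) → v ⬝ᵥ ((U₀ᵀ * B⁻¹ * U₀) *ᵥ v) ≤ 0)
    {a b : ℝ} (ha0 : 0 < a) (hab : a < b) (ha : (𝔽o[a]).det ≠ 0) (hb : (𝔽o[b]).det ≠ 0)
    (htype : ∀ t, a < t → t < b → (𝔽o[t]).det = 0 →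
      (∀ u : ι → ℝ, (𝔽o[t]) *ᵥ u = 0 → u ≠ 0 → (derivative (ℙ[u])).eval t < 0) ∨
      (∀ u : ι → ℝ, (𝔽o[t]) *ᵥ u = 0 → u ≠ 0 → 0 < (derivative (ℙ[u])).eval t))
    (negType : ℝ → Prop) [DecidablePred negType]
    (hnegType : ∀ t, a < t → t < b → (𝔽o[t]).det = 0 →
      (negType t ↔ ∀ u : ι → ℝ, (𝔽o[t]) *ᵥ u = 0 → u ≠ 0 → (derivative (ℙ[u])).eval t < 0)) :
    Multiset.card ((Matrix.det (∑ o : Option (ρ₀ ⊕ ρ₁), ((Polynomial.X : Polynomial ℝ) ^ (𝕕 o)) • (𝕃 o).map Polynomial.C)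
        ).roots.filter (fun t => (a < t ∧ t < b) ∧ negType t))
      ≤ Multiset.card ((Matrix.det (∑ o : Option (ρ₀ ⊕ ρ₁), ((Polynomial.X : Polynomial ℝ) ^ (𝕕 o)) •
          (𝕃 o).map Polynomial.C)).roots.filter (fun t => (a < t ∧ t < b) ∧ ¬ negType t)) + Fintype.card ρ₁
    ∧ Multiset.card ((Matrix.det (∑ o : Option (ρ₀ ⊕ ρ₁), ((Polynomial.X : Polynomial ℝ) ^ (𝕕 o)) •
          (𝕃 o).map Polynomial.C)).roots.filter (fun t => (a < t ∧ t < b) ∧ ¬ negType t))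
      ≤ Multiset.card ((Matrix.det (∑ o : Option (ρ₀ ⊕ ρ₁), ((Polynomial.X : Polynomial ℝ) ^ (𝕕 o)) •
          (𝕃 o).map Polynomial.C)).roots.filter (fun t => (a < t ∧ t < b) ∧ negType t)) + Fintype.card ρ₁ := by
  classical
  have hS : ∀ o, (𝕃 o).IsSymm := isSymm_optionLetter hBs (Matrix.fromCols U₀ U₁) (Sum.elim σ₀ σ₁)
  have hB : B.IsHermitian := Inertia.isHermitian_of_isSymm hBs
  have hidx := (Inertia.index_formula (𝕕) (𝕃) hS hab ha hb htype negType hnegType).1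
  have hba := negIndex_optionPencil_band B U₀ U₁ σ₀ σ₁ e δ₀ δ₁ hBs hBu hσ₀ hσ₁ hP hN ha0 hB
    (Inertia.isHermitian_pencil (𝕕) (𝕃) hS a)
  have hbb := negIndex_optionPencil_band B U₀ U₁ σ₀ σ₁ e δ₀ δ₁ hBs hBu hσ₀ hσ₁ hP hN (lt_trans ha0 hab) hB
    (Inertia.isHermitian_pencil (𝕕) (𝕃) hS b)
  have hk : Fintype.card {j // 0 < σ₁ j} ≤ Fintype.card ρ₁ := Fintype.card_subtype_le _
  beta_reduce
  constructor <;> omega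

end Window

end GramDual

end Summit.ValiantsHypothesis.ValiantsHypothesis.Theorems.LacunarySymmetroidMatrixDescartes
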